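import Mathlib
import HarnessLib
import Summits.Ventures.LatticeQCDFlow.Scaling.AcceptanceVolumeMonotone
import Summits.Ventures.LatticeQCDFlow.Scaling.IdentityFlowAcceptanceCouplingStrict

/-!
# LatticeQCDFlow / Scaling — the untrained 2-d U(1) sampler's acceptance `acc_V(β)` is JOINTLY
# decreasing in the coupling `β ≥ 0` and the volume `V`: every super-level set
# `{(β, V) : acc_V(β) ≥ a}` is a down-set of `[0, ∞) × ℕ`

HONEST FRAMING: exact (Metropolis-corrected) sampling algorithms for lattice gauge theory;
figures of merit are autocorrelation/cost numbers at stated couplings and volumes; no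
continuum-physics claim.

Venture `LatticeQCDFlow` (cell pub-lqcd), topic `Scaling`; FANOUT row 3 (`s0-u1-a`, S0-B
implementation A, GEN-17).  ASSEMBLY of two laws of row 3 (no new estimate); NO definition is
introduced.  Volume: `Scaling/AcceptanceVolumeMonotone.u1IdentityFlow_meanAccept_succ_lt` (GEN-14,
imported) — `acc_{V+1}(β) < acc_V(β)` for `β ≠ 0`.  Coupling:
`Scaling/IdentityFlowAcceptanceCouplingMonotone.u1IdentityFlow_meanAccept_antitoneOn` and
`Scaling/IdentityFlowAcceptanceCouplingStrict.u1IdentityFlow_meanAccept_strictAntiOn` (GEN-17,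
imported) — `acc_V` is (strictly, `V ≥ 1`) decreasing on `[0, ∞)`.  Here `acc_V(β)` is the
equilibrium acceptance of the exact sampler proposing `V` independent plaquette angles from the
Haar prior against the product Wilson weight at coupling `β` (`Scaling/U1IdentityFlowVolumeLaw`),
plaquettes indexed by `Fin V`.

* `integral_u1Haar_pi`, **`u1IdentityFlow_meanAccept_zero`** — `acc_V(0) = 1` (proposal = target);
* **`u1IdentityFlow_meanAccept_volume_antitone`** — `V ≤ V′ ⇒ acc_{V′}(β) ≤ acc_V(β)`, every real `β`;
  **`u1IdentityFlow_meanAccept_volume_strictAnti`** — `V < V′`, `β ≠ 0 ⇒` strict;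
* **`u1IdentityFlow_meanAccept_jointly_antitone`** — `0 ≤ β ≤ β′`, `V ≤ V′ ⇒ acc_{V′}(β′) ≤ acc_V(β)`;
  **`u1IdentityFlow_meanAccept_jointly_strictAnti`** — strict as soon as `β < β′` with `V′ ≥ 1`, or
  `V < V′` with `β′ ≠ 0`.

Reading (value-free; no number of ours is computed or implied): for the zero-training baseline of
the cell's 2-d U(1) ladder, an acceptance target that fails at one `(β, L)` fails at every larger
coupling and every larger volume, and one that holds at `(β, L)` holds at every smaller pair — the
monotone shape against which a trained flow's `(β, L)` table is read.  NOT CLAIMED: the analogous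
joint law for the torus-constrained model or for Wilson theories in `d ≥ 3` (volume monotonicity is
typed for product models only); trained flows; any value at the cell's `(β, L)`; nothing re-scored,
SEALED.md untouched.
-/

noncomputable section

namespace Summit.Ventures.LatticeQCDFlow.Theory2

open MeasureTheory Real Set Finset
open Summit.Ventures.LatticeQCDFlow.Scoring (onePlaquetteZ onePlaquetteZ_pos)

/-- The constant product-Haar density integrates to `1` over `(0, 2π]^V`. [folklore] -/
theorem integral_u1Haar_pi (V : ℕ) :
    ∫ _x : Fin V → ℝ, (∏ _i : Fin V, (1 / (2 * π) : ℝ))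
      ∂(Measure.pi fun _ : Fin V => volume.restrict (Ioc (0 : ℝ) (2 * π))) = 1 := by
  rw [show (fun _x : Fin V → ℝ => ∏ _i : Fin V, (1 / (2 * π) : ℝ))
      = fun x : Fin V → ℝ => ∏ i : Fin V, (fun (_ : Fin V) (_ : ℝ) => (1 / (2 * π) : ℝ)) i (x i)
      from rfl,
    integral_fintype_prod_eq_prod (μ := fun _ : Fin V => volume.restrict (Ioc (0 : ℝ) (2 * π)))
      (fun (_ : Fin V) (_ : ℝ) => (1 / (2 * π) : ℝ)),
    prod_eq_one fun i _ => integral_u1Haar]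

/-- **At `β = 0` the untrained U(1) sampler is perfect: `acc_V(0) = 1`** (proposal = target). [ours] -/
theorem u1IdentityFlow_meanAccept_zero (V : ℕ) :
    ∫ x, ∫ x', min ((∏ i : Fin V, Real.exp (0 * Real.cos (x i)) / onePlaquetteZ 0)
          * ∏ _i : Fin V, (1 / (2 * π) : ℝ))
        ((∏ i : Fin V, Real.exp (0 * Real.cos (x' i)) / onePlaquetteZ 0) * ∏ _i : Fin V, (1 / (2 * π) : ℝ))
        ∂(Measure.pi fun _ : Fin V => volume.restrict (Ioc (0 : ℝ) (2 * π)))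
        ∂(Measure.pi fun _ : Fin V => volume.restrict (Ioc (0 : ℝ) (2 * π))) = 1 := by
  have h1 := integral_u1Haar_pi V
  have h2 : ∫ _x : Fin V → ℝ, ∫ _x' : Fin V → ℝ, (∏ _i : Fin V, (1 / (2 * π) : ℝ))
      * ∏ _i : Fin V, (1 / (2 * π) : ℝ) ∂(Measure.pi fun _ : Fin V => volume.restrict (Ioc (0 : ℝ) (2 * π)))
      ∂(Measure.pi fun _ : Fin V => volume.restrict (Ioc (0 : ℝ) (2 * π))) = 1 := by
    have e : (fun _x : Fin V → ℝ => ∫ _x' : Fin V → ℝ, (∏ _i : Fin V, (1 / (2 * π) : ℝ))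
        * ∏ _i : Fin V, (1 / (2 * π) : ℝ) ∂(Measure.pi fun _ : Fin V => volume.restrict (Ioc (0 : ℝ) (2 * π))))
        = fun _ => ∏ _i : Fin V, (1 / (2 * π) : ℝ) := by
      funext x; rw [integral_const_mul, h1, mul_one]
    rw [e, h1]
  rw [u1IdentityFlow_meanAccept_eq_ratio (ι := Fin V) 0]
  simp only [zero_mul, Real.exp_zero, min_self, mul_one]
  rw [h2, h1, div_one]

/-- **MONOTONE IN THE VOLUME**: `V ≤ V′ ⇒ acc_{V′}(β) ≤ acc_V(β)` for every real `β` (row 3's strict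
one-step law `Scaling/AcceptanceVolumeMonotone.u1IdentityFlow_meanAccept_succ_lt`, iterated; at
`β = 0` both sides equal `1`). [ours] -/
theorem u1IdentityFlow_meanAccept_volume_antitone (β : ℝ) {V V' : ℕ} (hVV' : V ≤ V') :
    ∫ x, ∫ x', min ((∏ i : Fin V', Real.exp (β * Real.cos (x i)) / onePlaquetteZ β)
          * ∏ _i : Fin V', (1 / (2 * π) : ℝ))
        ((∏ i : Fin V', Real.exp (β * Real.cos (x' i)) / onePlaquetteZ β) * ∏ _i : Fin V', (1 / (2 * π) : ℝ))
        ∂(Measure.pi fun _ : Fin V' => volume.restrict (Ioc (0 : ℝ) (2 * π)))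
        ∂(Measure.pi fun _ : Fin V' => volume.restrict (Ioc (0 : ℝ) (2 * π)))
      ≤ ∫ x, ∫ x', min ((∏ i : Fin V, Real.exp (β * Real.cos (x i)) / onePlaquetteZ β)
          * ∏ _i : Fin V, (1 / (2 * π) : ℝ))
        ((∏ i : Fin V, Real.exp (β * Real.cos (x' i)) / onePlaquetteZ β) * ∏ _i : Fin V, (1 / (2 * π) : ℝ))
        ∂(Measure.pi fun _ : Fin V => volume.restrict (Ioc (0 : ℝ) (2 * π)))
        ∂(Measure.pi fun _ : Fin V => volume.restrict (Ioc (0 : ℝ) (2 * π))) := by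
  rcases eq_or_ne β 0 with rfl | hβ
  · rw [u1IdentityFlow_meanAccept_zero, u1IdentityFlow_meanAccept_zero]
  · induction hVV' with
    | refl => exact le_rfl
    | step _ ih => exact (u1IdentityFlow_meanAccept_succ_lt hβ _).le.trans ih

/-- **STRICTLY, for `β ≠ 0`**: `V < V′ ⇒ acc_{V′}(β) < acc_V(β)`. [ours] -/
theorem u1IdentityFlow_meanAccept_volume_strictAnti {β : ℝ} (hβ : β ≠ 0) {V V' : ℕ} (hVV' : V < V') :
    ∫ x, ∫ x', min ((∏ i : Fin V', Real.exp (β * Real.cos (x i)) / onePlaquetteZ β)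
          * ∏ _i : Fin V', (1 / (2 * π) : ℝ))
        ((∏ i : Fin V', Real.exp (β * Real.cos (x' i)) / onePlaquetteZ β) * ∏ _i : Fin V', (1 / (2 * π) : ℝ))
        ∂(Measure.pi fun _ : Fin V' => volume.restrict (Ioc (0 : ℝ) (2 * π)))
        ∂(Measure.pi fun _ : Fin V' => volume.restrict (Ioc (0 : ℝ) (2 * π)))
      < ∫ x, ∫ x', min ((∏ i : Fin V, Real.exp (β * Real.cos (x i)) / onePlaquetteZ β)
          * ∏ _i : Fin V, (1 / (2 * π) : ℝ))
        ((∏ i : Fin V, Real.exp (β * Real.cos (x' i)) / onePlaquetteZ β) * ∏ _i : Fin V, (1 / (2 * π) : ℝ))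
        ∂(Measure.pi fun _ : Fin V => volume.restrict (Ioc (0 : ℝ) (2 * π)))
        ∂(Measure.pi fun _ : Fin V => volume.restrict (Ioc (0 : ℝ) (2 * π))) := by
  obtain ⟨k, rfl⟩ := Nat.exists_eq_add_of_lt hVV'
  calc _ < _ := u1IdentityFlow_meanAccept_succ_lt hβ (V + k)
    _ ≤ _ := u1IdentityFlow_meanAccept_volume_antitone β (Nat.le_add_right V k)

/-- **THE ACCEPTANCE OF THE UNTRAINED U(1) SAMPLER IS JOINTLY DECREASING IN COUPLING AND VOLUME**:
`0 ≤ β ≤ β′` and `V ≤ V′` imply `acc_{V′}(β′) ≤ acc_V(β)` — so every super-level set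
`{(β, V) : acc_V(β) ≥ a}` of the zero-training acceptance is a DOWN-SET of `[0, ∞) × ℕ`: a target
acceptance that fails at `(β, V)` fails at every larger coupling and every larger volume.  Coupling
step: `Scaling/IdentityFlowAcceptanceCouplingMonotone.u1IdentityFlow_meanAccept_antitoneOn`; volume
step: `u1IdentityFlow_meanAccept_volume_antitone`. [ours] -/
theorem u1IdentityFlow_meanAccept_jointly_antitone {β β' : ℝ} (hβ : 0 ≤ β) (hββ' : β ≤ β')
    {V V' : ℕ} (hVV' : V ≤ V') :
    ∫ x, ∫ x', min ((∏ i : Fin V', Real.exp (β' * Real.cos (x i)) / onePlaquetteZ β')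
          * ∏ _i : Fin V', (1 / (2 * π) : ℝ))
        ((∏ i : Fin V', Real.exp (β' * Real.cos (x' i)) / onePlaquetteZ β') * ∏ _i : Fin V', (1 / (2 * π) : ℝ))
        ∂(Measure.pi fun _ : Fin V' => volume.restrict (Ioc (0 : ℝ) (2 * π)))
        ∂(Measure.pi fun _ : Fin V' => volume.restrict (Ioc (0 : ℝ) (2 * π)))
      ≤ ∫ x, ∫ x', min ((∏ i : Fin V, Real.exp (β * Real.cos (x i)) / onePlaquetteZ β)
          * ∏ _i : Fin V, (1 / (2 * π) : ℝ))
        ((∏ i : Fin V, Real.exp (β * Real.cos (x' i)) / onePlaquetteZ β) * ∏ _i : Fin V, (1 / (2 * π) : ℝ))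
        ∂(Measure.pi fun _ : Fin V => volume.restrict (Ioc (0 : ℝ) (2 * π)))
        ∂(Measure.pi fun _ : Fin V => volume.restrict (Ioc (0 : ℝ) (2 * π))) := by
  have h1 := u1IdentityFlow_meanAccept_antitoneOn (ι := Fin V') (mem_Ici.2 hβ)
    (mem_Ici.2 (hβ.trans hββ')) hββ'
  beta_reduce at h1
  exact h1.trans (u1IdentityFlow_meanAccept_volume_antitone β hVV')

/-- **… STRICTLY off the degenerate cases**: if moreover `β < β′` with `V′ ≥ 1`, or `V < V′` with
`β′ ≠ 0`, then `acc_{V′}(β′) < acc_V(β)`. [ours] -/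
theorem u1IdentityFlow_meanAccept_jointly_strictAnti {β β' : ℝ} (hβ : 0 ≤ β) (hββ' : β ≤ β')
    {V V' : ℕ} (hVV' : V ≤ V') (h : (β < β' ∧ 1 ≤ V') ∨ (V < V' ∧ β' ≠ 0)) :
    ∫ x, ∫ x', min ((∏ i : Fin V', Real.exp (β' * Real.cos (x i)) / onePlaquetteZ β')
          * ∏ _i : Fin V', (1 / (2 * π) : ℝ))
        ((∏ i : Fin V', Real.exp (β' * Real.cos (x' i)) / onePlaquetteZ β') * ∏ _i : Fin V', (1 / (2 * π) : ℝ))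
        ∂(Measure.pi fun _ : Fin V' => volume.restrict (Ioc (0 : ℝ) (2 * π)))
        ∂(Measure.pi fun _ : Fin V' => volume.restrict (Ioc (0 : ℝ) (2 * π)))
      < ∫ x, ∫ x', min ((∏ i : Fin V, Real.exp (β * Real.cos (x i)) / onePlaquetteZ β)
          * ∏ _i : Fin V, (1 / (2 * π) : ℝ))
        ((∏ i : Fin V, Real.exp (β * Real.cos (x' i)) / onePlaquetteZ β) * ∏ _i : Fin V, (1 / (2 * π) : ℝ))
        ∂(Measure.pi fun _ : Fin V => volume.restrict (Ioc (0 : ℝ) (2 * π)))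
        ∂(Measure.pi fun _ : Fin V => volume.restrict (Ioc (0 : ℝ) (2 * π))) := by
  rcases h with ⟨hlt, hV'⟩ | ⟨hlt, hβ'⟩
  · haveI : Nonempty (Fin V') := ⟨⟨0, hV'⟩⟩
    have h1 := u1IdentityFlow_meanAccept_strictAntiOn (ι := Fin V') (mem_Ici.2 hβ)
      (mem_Ici.2 (hβ.trans hββ')) hlt
    beta_reduce at h1
    exact h1.trans_le (u1IdentityFlow_meanAccept_volume_antitone β hVV')
  · have h1 := u1IdentityFlow_meanAccept_antitoneOn (ι := Fin V) (mem_Ici.2 hβ)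
      (mem_Ici.2 (hβ.trans hββ')) hββ'
    beta_reduce at h1
    exact (u1IdentityFlow_meanAccept_volume_strictAnti hβ' hlt).trans_le h1

end Summit.Ventures.LatticeQCDFlow.Theory2
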